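import Summits.CriticalPhenomena.Ising3DConformalLimit.Theses.ArmHyperscaling
import Summits.CriticalPhenomena.Ising3DConformalLimit.Cruxes.IsingEuclidUpgradeR4NonGaussian.Disproof

/-!
# Crux attack on `MergingFloor` (stmt-CriticalPhenomena-15592, route ArmHyperscaling, crux r3)
refuter-rattack-stmt-CriticalPhenomena-15592-0, 2026-08-17 — ONE cycle of basic attacks, kernel-checked where possible.

`MergingFloor` : at some non-coincident quadruple `x ∈ (ℝ³)⁴` and some `c > 0`, for all small `δ > 0`,
`c·⟨σ_{[x₀/δ]}σ_{[x₁/δ]}⟩⟨σ_{[x₂/δ]}σ_{[x₃/δ]}⟩ ≤ −U₄^{lat}([x/δ])` (critical Ising on `ℤ³`, plus state at `β_c`).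

## Findings (section = theorem names below)
* §0 `mergingFloor_iff_latticeU4RatioPositive` (`Iff.rfl`): the crux is VERBATIM the ρ-free lattice target of crux 0636
  (`Cruxes/IsingEuclidUpgradeR4NonGaussian/Disproof.lean` §C).  Everything proved there about that target applies.
* §1 SIGN / VACUITY.  `rhs_nonneg`: the right-hand side `−U₄^{lat}` is `≥ 0` at EVERY mesh (Lebowitz) — so the sign convention
  of the statement is the right one and `0 < c` is the whole content: `weakenPos_trivial` (the statement with `0 ≤ c` is
  trivially true).  `const_le_two`: any admissible constant has `c ≤ 2` (ADC21 (3.12): `|U₄^{lat}| ≤ 2⟨σσ⟩⟨σσ⟩`), i.e. the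
  statement says exactly "a merging PROBABILITY is `≥ c/2 > 0` uniformly in the scale" — as the informal gloss claims.
* §2 DEGENERATE WITNESSES.  `dropNonCoincident_trivial`: WITHOUT `x ∈ NonCoincident 3 4` the statement is trivially true
  (constant configuration: all correlators `= 1`, `−U₄^{lat} = 2`, `c = 2`).  So non-coincidence is load-bearing against junk,
  and the filed statement HAS it: no degenerate witness survives (an injective `x` has pairwise `[xᵢ/δ] ≠ [xⱼ/δ]` eventually,
  `eventually_injective_latticeApprox` of the 0636 Disproof).
* §3 RESTATES-THE-SUMMIT PROBES.  S → C HOLDS: `mergingFloor_of_exists_nontrivialLimit` (any non-degenerate pointwise limit with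
  `U₄ ≢ 0` forces the floor) and its corollary `mergingFloor_of_summit : Ising3DConformalLimit → MergingFloor`.  Hence the crux is
  NECESSARY for the conjunct: `¬MergingFloor` would refute `Ising3DConformalLimit` itself (kill criterion of the route, confirmed).
  C → S is NOT derivable (prose): `MergingFloor` is a pure lattice inequality at one shape; it says nothing about existence of the
  full-filter limit (crux E = stmt-1981) nor covariance (1982/15593); on the route it is exactly clause (iii):
  `mergingFloor_iff_crux0636_of_E : ExistsScaleCovariantLimit → (MergingFloor ↔ crux 0636)`, and unconditionally
  `crux0636_of_mergingFloor`.  So the crux is a genuine proper part of the summit, neither a costume of it nor independent of it.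
* §4 QUANTIFIER ORDER / NORMALISATION (prose).  `∃ x ∃ c ∀ᶠ δ` = "one shape, one constant, all small meshes" = the informal text;
  the uniformity of `c` in `δ` is the load-bearing order (`∀ᶠ δ ∃ c` is free by §1).  The statement is ρ-free (a ratio at fixed
  shape), so no normalisation can be missing; `latticeApprox = ⌊·/δ⌋`, `criticalCorr` is a genuine box limit
  (`criticalCorr_is_boxLimit`, 0636 Disproof §A.0) — no `limUnder`/`sInf` junk reachable.
* §5 A WEAKER SUFFICIENT FORM (planner information, not a defect): `mergingFloorSeq_suffices_for_U4` — the same inequality along ONE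
  sequence of meshes `u_k → 0⁺` already gives clause (iii) for every non-degenerate limit (0636 Disproof §C.1′); the route's `closes`
  would go through with it verbatim (it only evaluates the floor along the limit filter).
* §6 CHEAP FALSIFIER.  Not finite/decidable (infinite-volume critical Ising₃, `β_c` not closed-form): no certified compute applies.
  Dimension probe (prose): the `ℤ^d`, `d ≥ 5` analogue is FALSE (Aizenman 1982 tree bound + infrared bound: `−U₄/⟨σσ⟩⟨σσ⟩ → 0` at every
  fixed shape; tree: `limitConnectedFour_eq_zero_of_hasPointwiseScalingLimit_holds`, 0636 Disproof §D) — consistent with barrier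
  `IsingTrivialityFromDimensionFour`: any proof must consume a `d = 3` input.  Non-certified numerics: kit job j024165 (torus SW at `β_c`,
  `p(L) = −U₄/(2⟨σσ⟩⟨σσ⟩)` at fixed shapes, jackknife errors; `reason=ok`): d = 3 square `(0,he₁,he₂,h(e₁+e₂))`, `h = L/4`:
  `p = 0.580(3), 0.589(3), 0.592(5), 0.589(4), 0.590(5), 0.588(7), 0.592(6), 0.593(8), 0.589(8)` for `L = 8,12,16,20,24,28,32,40,48` — a PLATEAU
  `p* ≈ 0.59` while `−U₄` itself falls by a factor 42; regular tetrahedron `p* ≈ 0.72`; d = 2 control `p* ≈ 0.90` (known non-Gaussian);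
  Binder ratios at the literature critical values (3D 1.59–1.61 vs 1.604; 2D 1.17 vs 1.168).  Evidence FOR the crux (`c ≈ 2p*` on the torus),
  not a proof; details in `CruxAttack.md` §Numerics.
VERDICT: survives (honest open problem = non-triviality of Ising₃ in lattice dress; NOT refuted, NOT trivial, NOT misstated).
-/

noncomputable section

namespace Summit.CriticalPhenomena.Ising3DConformalLimit.Cruxes.MergingFloor.CruxAttack

open Literature.Probability.LatticeModels Filter Set
open scoped Topology
open Summit.CriticalPhenomena.Ising3DConformalLimit.Theses.ArmHyperscaling (MergingFloor ExistsScaleCovariantLimit)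
open Summit.CriticalPhenomena.Ising3DConformalLimit.Cruxes.IsingEuclidUpgradeR4NonGaussian.Disproof
  (Crux LatticeU4RatioPositive LatticeU4RatioPositiveSeq latU4 iff_exists_form latticeU4RatioPositive_of
   of_latticeU4RatioPositive of_latticeU4RatioPositiveSeq latticeU4RatioPositiveSeq_of criticalCorr_two_pos
   CurrentsIntersectUniformly latticeU4RatioPositive_of_currentsIntersect)

/-! ## §0 The crux is the 0636 lattice target verbatim -/

/-- `MergingFloor` is, by `Iff.rfl`, the ρ-free lattice target `LatticeU4RatioPositive` of crux 0636. -/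
theorem mergingFloor_iff_latticeU4RatioPositive : MergingFloor ↔ LatticeU4RatioPositive := Iff.rfl

/-! ## §1 Sign and vacuity -/

/-- The right-hand side `−U₄^{lat}([x/δ])` is nonnegative at every mesh and every configuration (Lebowitz 1974). -/
theorem rhs_nonneg (δ : ℝ) (x : Fin 4 → EuclideanSpace ℝ (Fin 3)) : 0 ≤ - latU4 δ x := by
  have h := criticalUrsellFour_nonpos (d := 3) le_rfl (fun i => latticeApprox δ (x i))
  simp only [latU4]
  linarith [h]

/-- An explicit non-coincident quadruple: four points on the first axis. -/
def axisConfig : Fin 4 → EuclideanSpace ℝ (Fin 3) := fun i => ((i : ℕ) : ℝ) • EuclideanSpace.single (0 : Fin 3) (1 : ℝ)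

theorem axisConfig_mem : axisConfig ∈ NonCoincident 3 4 := by
  intro i j h
  have h0 := congrArg (fun v : EuclideanSpace ℝ (Fin 3) => v 0) h
  simp only [axisConfig, PiLp.smul_apply, PiLp.single_apply, if_true, smul_eq_mul, mul_one,
    Nat.cast_inj] at h0
  exact Fin.ext h0

/-- With `0 ≤ c` in place of `0 < c` the statement is TRIVIALLY true (`c = 0`, any configuration): positivity of the
constant is the entire content. -/
theorem weakenPos_trivial :
    ∃ x ∈ NonCoincident 3 4, ∃ c : ℝ, 0 ≤ c ∧ ∀ᶠ δ in 𝓝[>] (0:ℝ),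
      c * (criticalCorr 3 2 ![latticeApprox δ (x 0), latticeApprox δ (x 1)] *
        criticalCorr 3 2 ![latticeApprox δ (x 2), latticeApprox δ (x 3)]) ≤ - latU4 δ x :=
  ⟨axisConfig, axisConfig_mem, 0, le_rfl, Filter.Eventually.of_forall fun δ => by
    rw [zero_mul]; exact rhs_nonneg δ _⟩

/-- Any admissible constant satisfies `c ≤ 2`: `|U₄^{lat}| ≤ 2⟨σσ⟩⟨σσ⟩` (ADC 2021 (3.12)) and `⟨σσ⟩ > 0` on `ℤ³`;
so the crux asserts that a PROBABILITY (`−U₄/2⟨σσ⟩⟨σσ⟩ ∈ [0,1]`, the double-current merging probability) stays `≥ c/2`. -/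
theorem const_le_two {x : Fin 4 → EuclideanSpace ℝ (Fin 3)} {c : ℝ}
    (hev : ∀ᶠ δ in 𝓝[>] (0:ℝ),
      c * (criticalCorr 3 2 ![latticeApprox δ (x 0), latticeApprox δ (x 1)] *
        criticalCorr 3 2 ![latticeApprox δ (x 2), latticeApprox δ (x 3)]) ≤ - latU4 δ x) : c ≤ 2 := by
  obtain ⟨δ, hδ⟩ := hev.exists
  set P : ℝ := criticalCorr 3 2 ![latticeApprox δ (x 0), latticeApprox δ (x 1)] *
    criticalCorr 3 2 ![latticeApprox δ (x 2), latticeApprox δ (x 3)] with hP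
  have hPpos : 0 < P := mul_pos (criticalCorr_two_pos _ _) (criticalCorr_two_pos _ _)
  have habs := abs_criticalUrsellFour_le_two_mul (d := 3) le_rfl (fun i => latticeApprox δ (x i))
  have hup : - latU4 δ x ≤ 2 * P := by
    have h1 : - latU4 δ x ≤ |latU4 δ x| := neg_le_abs _
    have h2 : |latU4 δ x| ≤ 2 * P := by
      simp only [latU4, hP]
      simpa [mul_assoc] using habs
    linarith
  exact le_of_mul_le_mul_right (hδ.trans hup) hPpos

/-! ## §2 Degenerate witnesses: non-coincidence is load-bearing against junk -/

theorem plusExpect_const' (c : ℝ) : plusExpect 3 (criticalBeta 3) 0 (fun _ => c) = c := by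
  simp only [plusExpect, isingExpect_const]
  exact tendsto_const_nhds.limUnder_eq

theorem criticalCorr_two_self' (a : Site 3) : criticalCorr 3 2 ![a, a] = 1 := by
  have hmono : spinMonomial ![a, a] = fun _ : SpinConfig (Site 3) => (1 : ℝ) := by
    funext s; simp [spinMonomial, Fin.prod_univ_two]
  simp only [criticalCorr, hmono]
  exact plusExpect_const' 1

theorem criticalCorr_four_const' (a : Site 3) : criticalCorr 3 4 (fun _ : Fin 4 => a) = 1 := by
  have hmono : spinMonomial (fun _ : Fin 4 => a) = fun _ : SpinConfig (Site 3) => (1 : ℝ) := by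
    funext s
    simp only [spinMonomial, Finset.prod_const, Finset.card_univ, Fintype.card_fin]
    rw [show (4:ℕ) = 2 * 2 from rfl, pow_mul, spinAt_sq, one_pow]
  simp only [criticalCorr, hmono]
  exact plusExpect_const' 1

/-- WITHOUT `x ∈ NonCoincident 3 4` the statement is trivially true: the constant configuration with `c = 2`
(`⟨σ_y⁴⟩ = ⟨σ_y²⟩ = 1`, so `−U₄^{lat} = 3 − 1 = 2 = 2·1·1`). The filed statement excludes this junk witness. -/
theorem dropNonCoincident_trivial :
    ∃ x : Fin 4 → EuclideanSpace ℝ (Fin 3), ∃ c : ℝ, 0 < c ∧ ∀ᶠ δ in 𝓝[>] (0:ℝ),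
      c * (criticalCorr 3 2 ![latticeApprox δ (x 0), latticeApprox δ (x 1)] *
        criticalCorr 3 2 ![latticeApprox δ (x 2), latticeApprox δ (x 3)]) ≤ - latU4 δ x := by
  refine ⟨fun _ => 0, 2, two_pos, Filter.Eventually.of_forall fun δ => ?_⟩
  dsimp only
  simp only [latU4, criticalCorr_two_self', criticalCorr_four_const']
  norm_num

/-! ## §3 Restates-the-summit probes: S → C holds (kernel-checked); C ↔ clause (iii) given (E) -/

/-- Any non-degenerate pointwise scaling limit of `criticalCorr 3` with `U₄ ≢ 0` FORCES the merging floor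
(Lebowitz sign in the limit + convergence of the rescaled Ursell function; 0636 Disproof §B.4 + §C.2). -/
theorem mergingFloor_of_exists_nontrivialLimit
    (h : ∃ (ρ : ℝ → ℝ) (S : CorrFamily 3), (∀ δ ∈ Set.Ioc (0:ℝ) 1, 0 < ρ δ) ∧
      HasPointwiseScalingLimit (criticalCorr 3) ρ S ∧ IsNondegenerateTwoPoint S ∧ HasNontrivialU4 S) :
    MergingFloor := by
  obtain ⟨ρ, S, hρ, hlim, hnd, hU⟩ := h
  have hcrux : Crux := iff_exists_form.2 fun _ => ⟨ρ, S, hρ, hlim, hnd, hU⟩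
  exact latticeU4RatioPositive_of hcrux hρ hlim hnd

/-- **S → C**: the summit conjunct implies the crux. So `MergingFloor` is NECESSARY: its refutation would refute
`Ising3DConformalLimit` itself. -/
theorem mergingFloor_of_summit (h : _root_.Ising3DConformalLimit) : MergingFloor := by
  obtain ⟨ρ, Δ, S, hρ, _hΔ, hlim, hnd, _hmob, hU⟩ := h
  exact mergingFloor_of_exists_nontrivialLimit ⟨ρ, S, hρ, hlim, hnd, hU⟩

/-- Unconditionally, the crux gives crux 0636 (`NonGaussianLimit`: every non-degenerate limit has `U₄ ≢ 0`). -/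
theorem crux0636_of_mergingFloor (h : MergingFloor) : Crux := of_latticeU4RatioPositive h

/-- On this route (given its crux E = `ExistsScaleCovariantLimit`, in fact given ANY non-degenerate limit) the crux is
EQUIVALENT to crux 0636, i.e. to clause (iii) of the summit: it is exactly the non-triviality residue, no more. -/
theorem mergingFloor_iff_crux0636_of_E (hE : ExistsScaleCovariantLimit) : MergingFloor ↔ Crux := by
  obtain ⟨ρ, Δ, S, hρ, _hΔ, hlim, _hnorm, hnd, _htr, _hsc⟩ := hE
  exact ⟨of_latticeU4RatioPositive, fun h => latticeU4RatioPositive_of h hρ hlim hnd⟩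

/-- The random-current form of the informal gloss: uniform (box-level) intersection of the two sourced double currents of
`{[x₀/δ],[x₁/δ]}` and `{[x₂/δ],[x₃/δ]}` gives the crux (ADC 2021 (3.11), proved box identity; 0636 Disproof §C.4). -/
theorem mergingFloor_of_currentsIntersect (h : CurrentsIntersectUniformly) : MergingFloor :=
  latticeU4RatioPositive_of_currentsIntersect h

/-! ## §5 A weaker sufficient form (one mesh sequence) -/

/-- The sequential floor (one sequence `u_k → 0⁺`) is implied by the crux and already suffices for clause (iii) of every
non-degenerate limit — the route's `closes` needs no more than this. -/
theorem mergingFloorSeq_suffices_for_U4 :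
    (MergingFloor → LatticeU4RatioPositiveSeq) ∧ (LatticeU4RatioPositiveSeq → Crux) :=
  ⟨latticeU4RatioPositiveSeq_of, of_latticeU4RatioPositiveSeq⟩

end Summit.CriticalPhenomena.Ising3DConformalLimit.Cruxes.MergingFloor.CruxAttack

end
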